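/-
Copyright (c) 2026. All rights reserved.
Released under Apache 2.0 license as described in the file LICENSE.
Authors: abc-iut cell, Cor. 3.12 sub-crew seat abc-iut-c312-3 (gen 9).
-/
import Literature.IUT.LogVolume.UnitLogInnerRadiusTie
import HarnessLib

/-!
# The inner radius at a TIE index `e = A·(p−1)` (`p` odd, `p ∤ A`), II: the lift to `ζ_p` and
# `r_in = A = e/(p−1)` EXACTLY when `ζ_p ∉ K`

Proof-only sequel (theorems, no definitions, no named fact) of `UnitLogInnerRadiusTie.lean` (the level-`A`
congruence `‖L(1 + ϖ^A a) − ϖ^A·(a + c·a^p)‖ ≤ ‖ϖ‖^{A+1}`, `c = ϖ^e/p`, and the gap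
`{‖z‖ ≤ ‖ϖ‖^{A−1}} ⊄ log_p(𝒪_K^×)`), transporting abc-iut-w4/w6's boundary-ramification method
(`UnitLogBoundaryRamificationRoots` §3–§5: residue polynomial `ā ↦ ā + c̄·ā^p`, transfer `K ↔ 𝒪_K/𝔪_K`) from
level `1` (`e = p − 1`) to the critical level `A = e/(p−1)`.  Setting: `K` a proper ultrametric normed
`ℚ_p`-algebra field, `p` ODD, `e = absRamificationIdx p K = A·(p−1)` with `p ∤ A`, `ϖ` a norm uniformizer.

* §4 **THE LIFT** (`exists_pow_prime_eq_one_of_unit_zero`): a UNIT `a` with `a + c·a^p ∈ 𝔪` yields a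
  non-trivial `p`-th root of unity in `K` (`y = 1 + ϖ^A a` has `L(y) ∈ 𝔪^{A+1} = L(U^{(A+1)})`, so `y = ζ·u`
  with `L(ζ) = 0`; a principal `ζ ≠ 1` with `L(ζ) = 0` has level EXACTLY `A` when `p ∤ A`
  (`norm_one_sub_eq_of_logSeries_eq_zero`, by the strict level envelopes), and `ζ^p ∈ U^{(A+1)}`
  (`norm_one_add_pow_prime_sub_one_le_level`) where `L` is injective, so `ζ^p = 1`); conversely a
  non-trivial `ζ_p` gives a unit zero (`exists_unit_zero_of_pow_prime_eq_one`).
* §5 **`ζ_p ∉ K` ⇒ `{‖z‖ ≤ ‖ϖ‖^A} ⊆ log_p(𝒪_K^×)`** (`closedBall_level_subset_logUnits_of_forall_pow_prime_eq_one`: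
  trivial kernel ⇒ the residue polynomial is onto the finite residue field; every `z ∈ 𝔪^A` is `L(1 + ϖ^A a)`
  up to `𝔪^{A+1} ⊆ log_p(𝒪^×)`), hence **`r_in = A = e/(p−1)` EXACTLY**
  (`innerRadius_tie_of_forall_pow_prime_eq_one`: `closedBall 0 ‖ϖ‖^A ⊆ logUnits K ∧
  ¬ closedBall 0 ‖ϖ‖^{A−1} ⊆ logUnits K`).  (`ζ_p ∈ K` ⇒ `r_in = A + 1` is left to a sequel.)

References: [cite: NeukirchANT1999, Ch. II Prop. (5.5)–(5.7)] [cite: Washington1997, Lemma 1.4, §5.1]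
[cite: Koblitz1984, Ch. IV §1–2].  Classical; `logUnits` is the cell's typing of [IUTchIV] Prop. 1.2's
`log_p(R^×)` ([claim: Mochizuki2012, status: disputed] for that locution only).  Consumer (record only):
D-0079 R-W lane U column «rho_in» at tie places.  Nothing here is disputed mathematics; no IUT statement is
asserted; nothing bears on [IUTchIII] Cor. 3.12.
-/

noncomputable section

open Metric Set
open scoped NormedField

namespace Literature.IUT.LogVolume

namespace LogEnvelope

open RamificationCriterion BoundaryRamification Literature.NumberTheory.GaloisRepresentations.Ultrametric

section Field

variable (p : ℕ) [hp : Fact p.Prime]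
variable {K : Type*} [NontriviallyNormedField K] [instK : NormedAlgebra ℚ_[p] K] [IsUltrametricDist K]
  [ProperSpace K]
variable {ϖ : Kˣ} (hϖ : IsUniformizer ϖ) {A : ℕ} (hA : absRamificationIdx p K = A * (p - 1))
include hϖ hA

/-! ### §4. The lift: unit zeros of the residue polynomial ↔ non-trivial `p`-th roots of unity -/

/-- `‖ϖ‖^{A+1}·p^{1/(p−1)} < 1`: the ball of radius `‖ϖ‖^{A+1}` is inside the isometry range of `log_p`.
[cite: NeukirchANT1999, Ch. II (5.5)] -/
theorem pow_level_succ_mul_rpow_lt_one :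
    ‖(ϖ : K)‖ ^ (A + 1) * (p : ℝ) ^ (1 / ((p : ℝ) - 1)) < 1 := by
  have hp1 : (1 : ℝ) < p := by exact_mod_cast hp.out.one_lt
  have hp0 : (0 : ℝ) < p := by linarith
  have hq0 : 0 < p - 1 := by have := hp.out.two_le; omega
  have he0 : (0 : ℝ) < (absRamificationIdx p K : ℝ) := by exact_mod_cast absRamificationIdx_pos p K
  have hlt : ((absRamificationIdx p K : ℕ) : ℝ) < ((A : ℝ) + 1) * ((p : ℝ) - 1) := by
    have h : ((absRamificationIdx p K : ℕ) : ℝ) = (A : ℝ) * ((p : ℝ) - 1) := by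
      rw [hA]; push_cast [Nat.cast_sub hp.out.one_le]; ring
    rw [h]; nlinarith
  rw [← Real.rpow_natCast, norm_eq_rpow_of_isUniformizer p K hϖ, ← Real.rpow_mul hp0.le, ← Real.rpow_add hp0]
  refine Real.rpow_lt_one_of_one_lt_of_neg hp1 ?_
  have hpe : (0 : ℝ) < (p : ℝ) - 1 := by linarith
  have key : (1 : ℝ) / ((p : ℝ) - 1) < ((A : ℝ) + 1) / (absRamificationIdx p K : ℝ) := by
    rw [div_lt_div_iff₀ hpe he0]; linarith
  have hrw : ((A : ℝ) + 1) / (absRamificationIdx p K : ℝ) = 1 / (absRamificationIdx p K : ℝ) * ((A : ℝ) + 1) := by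
    ring
  push_cast
  linarith [key, hrw]

/-- **`‖(1 + x)^p − 1‖ ≤ ‖ϖ‖^{A+1}` for `‖x‖ ≤ ‖ϖ‖^A`**: in `𝒪`, `(x + 1)^p = x^p + 1 + p·x·r`, and
`‖x^p‖ ≤ ‖ϖ‖^{A·p} ≤ ‖ϖ‖^{A+1}`, `‖p·x·r‖ ≤ ‖ϖ‖^{e+A} ≤ ‖ϖ‖^{A+1}`. [cite: NeukirchANT1999, Ch. II (5.5)] -/
theorem norm_one_add_pow_prime_sub_one_le_level {x : K} (hx : ‖x‖ ≤ ‖(ϖ : K)‖ ^ A) :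
    ‖(1 + x) ^ p - 1‖ ≤ ‖(ϖ : K)‖ ^ (A + 1) := by
  have hρ0 : 0 < ‖(ϖ : K)‖ := norm_units_pos ϖ
  have hρ1 : ‖(ϖ : K)‖ ≤ 1 := hϖ.1.le
  have hA1 := one_le_level p hA
  have hx1 : ‖x‖ ≤ 1 := hx.trans (pow_le_one₀ hρ0.le hρ1)
  set X : Valued.integer K := ⟨x, Valued.integer.mem_iff.mpr hx1⟩ with hX
  obtain ⟨r, hr⟩ := exists_add_pow_prime_eq hp.out X (1 : Valued.integer K)
  have hr' : (x + 1) ^ p = x ^ p + 1 + (p : K) * x * 1 * (r : K) := by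
    have := congrArg (fun z : Valued.integer K => (z : K)) hr
    simpa [hX] using this
  have hrn : ‖(r : K)‖ ≤ 1 := Valued.integer.norm_le_one r
  rw [add_comm (1 : K) x, hr', show x ^ p + 1 + (p : K) * x * 1 * (r : K) - 1 = x ^ p + (p : K) * x * (r : K) by ring]
  refine (IsUltrametricDist.norm_add_le_max _ _).trans (max_le ?_ ?_)
  · rw [norm_pow]
    calc ‖x‖ ^ p ≤ (‖(ϖ : K)‖ ^ A) ^ p := pow_le_pow_left₀ (norm_nonneg _) hx _
      _ = ‖(ϖ : K)‖ ^ (A * p) := (pow_mul _ _ _).symm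
      _ ≤ ‖(ϖ : K)‖ ^ (A + 1) := pow_le_pow_of_le_one hρ0.le hρ1 (by nlinarith [hp.out.two_le])
  · rw [norm_mul, norm_mul, norm_prime_eq_norm_pow p K hϖ]
    calc ‖(ϖ : K)‖ ^ absRamificationIdx p K * ‖x‖ * ‖(r : K)‖
        ≤ ‖(ϖ : K)‖ ^ absRamificationIdx p K * ‖(ϖ : K)‖ ^ A * 1 := by gcongr
      _ = ‖(ϖ : K)‖ ^ (absRamificationIdx p K + A) := by rw [mul_one, pow_add]
      _ ≤ ‖(ϖ : K)‖ ^ (A + 1) :=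
          pow_le_pow_of_le_one hρ0.le hρ1 (by have := absRamificationIdx_pos p K; omega)

/-- **A principal unit `ζ ≠ 1` with `L(ζ) = 0` has level exactly `A`** (`p ∤ A`): at any other level the
logarithm of a principal unit is nonzero (strict envelope), and `ζ ≠ 1` has some level.
[cite: NeukirchANT1999, Ch. II (5.7)] -/
theorem norm_one_sub_eq_of_logSeries_eq_zero (hpA : ¬ p ∣ A) {ζ : K} (hζP : IsPrincipal ζ) (hζ1 : ζ ≠ 1)
    (hL : logSeries ζ = 0) : ‖1 - ζ‖ = ‖(ϖ : K)‖ ^ A := by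
  have hρ0 : 0 < ‖(ϖ : K)‖ := norm_units_pos ϖ
  have hx : (1 : K) - ζ ≠ 0 := sub_ne_zero.mpr (Ne.symm hζ1)
  obtain ⟨s, hs⟩ := hϖ.2 (Units.mk0 (1 - ζ) hx)
  rw [Units.val_mk0] at hs
  have hs1 : 1 ≤ s := by
    have h1 : ‖(ϖ : K)‖ ^ s < 1 := hs ▸ hζP
    have := (zpow_lt_one_iff_right_of_lt_one₀ hρ0 hϖ.1).mp h1
    omega
  by_cases hsA : s = A
  · rw [hs, hsA, zpow_natCast]
  · exfalso
    obtain ⟨a₀, hlo, hhi⟩ := exists_turning_level (p := p) hs1 (absRamificationIdx p K)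
    have hhi' := lt_of_le_of_ne_level p hA hpA hs1 (fun h => hsA (by exact_mod_cast h)) hhi
    have hnorm := norm_logSeries_eq_zpow_level p hϖ hs1 hlo hhi' hs
    rw [hL, norm_zero] at hnorm
    exact (ne_of_gt (zpow_pos hρ0 _)) hnorm.symm

/-- **THE LIFT: a unit zero of the residue polynomial gives a non-trivial `p`-th root of unity** (`p` odd,
`p ∤ A`): for a unit `a` with `‖a + c·a^p‖ < 1`, `y := 1 + ϖ^A a` has `‖L(y)‖ ≤ ‖ϖ‖^{A+1}`, so `L(y) = L(u)`
for some `u` with `‖1 − u‖ ≤ ‖ϖ‖^{A+1}`; `ζ := y·u⁻¹ ≠ 1` has `L(ζ) = 0`, level `A`, and `ζ^p ∈ U^{(A+1)}` with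
`L(ζ^p) = 0 = L(1)`, whence `ζ^p = 1` by injectivity of `L` on `U^{(A+1)}`.
[cite: Washington1997, Lemma 1.4, §5.1] [cite: NeukirchANT1999, Ch. II (5.7)] -/
theorem exists_pow_prime_eq_one_of_unit_zero (hp2 : p ≠ 2) (hpA : ¬ p ∣ A) {a : K} (ha : ‖a‖ = 1)
    (hΛ : ‖a + (ϖ : K) ^ absRamificationIdx p K / (p : K) * a ^ p‖ < 1) :
    ∃ ζ : K, ζ ^ p = 1 ∧ ζ ≠ 1 := by
  have hρ0 : 0 < ‖(ϖ : K)‖ := norm_units_pos ϖ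
  have hA1 := one_le_level p hA
  have hθ := pow_level_succ_mul_rpow_lt_one p hϖ hA
  set y : K := 1 + (ϖ : K) ^ A * a with hydef
  have hy1 : ‖1 - y‖ = ‖(ϖ : K)‖ ^ A := by
    rw [hydef, show (1 : K) - (1 + (ϖ : K) ^ A * a) = -((ϖ : K) ^ A * a) by ring, norm_neg, norm_mul,
      norm_pow, ha, mul_one]
  have hyP : IsPrincipal y := by
    show ‖1 - y‖ < 1
    rw [hy1]
    exact pow_lt_one₀ (norm_nonneg _) hϖ.1 (by omega)
  -- `‖L(y)‖ ≤ ‖ϖ‖^{A+1}`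
  have hLy : ‖logSeries y‖ ≤ ‖(ϖ : K)‖ ^ (A + 1) := by
    have hcong := norm_logSeries_sub_le_level p hϖ hA hp2 ha.le
    have hmain : ‖(ϖ : K) ^ A * (a + (ϖ : K) ^ absRamificationIdx p K / (p : K) * a ^ p)‖ ≤
        ‖(ϖ : K)‖ ^ (A + 1) := by
      rw [norm_mul, norm_pow, pow_succ]
      exact mul_le_mul_of_nonneg_left (hϖ.norm_le_of_norm_lt_one _ hΛ) (pow_nonneg hρ0.le _)
    have hsplit : logSeries y = (logSeries y -
        (ϖ : K) ^ A * (a + (ϖ : K) ^ absRamificationIdx p K / (p : K) * a ^ p)) +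
        (ϖ : K) ^ A * (a + (ϖ : K) ^ absRamificationIdx p K / (p : K) * a ^ p) := by ring
    rw [hsplit]
    exact (IsUltrametricDist.norm_add_le_max _ _).trans (max_le hcong hmain)
  -- `L(y) = L(u)` with `u ∈ U^{(A+1)}`
  obtain ⟨u, hu, huy⟩ := exists_logSeries_eq p K hθ hLy
  have huP : IsPrincipal u := lt_of_le_of_lt hu (pow_lt_one₀ (norm_nonneg _) hϖ.1 (by omega))
  have hu1 : ‖u‖ = 1 := huP.norm_eq_one
  have hu0 : u ≠ 0 := norm_ne_zero_iff.mp (by rw [hu1]; exact one_ne_zero)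
  -- `ζ := y·u⁻¹`
  set ζ : K := y * u⁻¹ with hζdef
  have hζP : IsPrincipal ζ := hyP.mul huP.inv
  have hLinv : logSeries u⁻¹ = -logSeries u := by
    have h := logSeries_mul p huP huP.inv
    rw [mul_inv_cancel₀ hu0, logSeries_one] at h
    linear_combination (-1 : K) * h
  have hLζ : logSeries ζ = 0 := by
    rw [hζdef, logSeries_mul p hyP huP.inv, hLinv, huy, add_neg_cancel]
  have hζ1 : ζ ≠ 1 := by
    intro h1
    have hyu : y = u := by
      have := congrArg (· * u) h1
      simpa [hζdef, inv_mul_cancel_right₀ hu0] using this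
    rw [hyu] at hy1
    have : ‖(ϖ : K)‖ ^ A ≤ ‖(ϖ : K)‖ ^ (A + 1) := hy1 ▸ hu
    exact absurd this (not_le.mpr (pow_lt_pow_right_of_lt_one₀ hρ0 hϖ.1 (by omega)))
  -- `ζ` has level `A`, so `ζ^p ∈ U^{(A+1)}`; and `L(ζ^p) = 0`
  have hζA := norm_one_sub_eq_of_logSeries_eq_zero p hϖ hA hpA hζP hζ1 hLζ
  have hζp1 : ‖1 - ζ ^ p‖ ≤ ‖(ϖ : K)‖ ^ (A + 1) := by
    have h := norm_one_add_pow_prime_sub_one_le_level p hϖ hA (x := ζ - 1)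
      (by rw [← norm_neg, neg_sub, hζA])
    rw [add_sub_cancel, ← norm_neg, neg_sub] at h
    exact h
  have hLζp : logSeries (ζ ^ p) = 0 := by rw [logSeries_pow p hζP, hLζ, mul_zero]
  refine ⟨ζ, ?_, hζ1⟩
  have h1mem : (1 : K) ∈ {w : K | ‖1 - w‖ ≤ ‖(ϖ : K)‖ ^ (A + 1)} := by
    rw [Set.mem_setOf_eq, sub_self, norm_zero]; positivity
  exact logSeries_injOn p K hθ hζp1 h1mem (by rw [hLζp, logSeries_one])

/-- **Conversely a non-trivial `p`-th root of unity has level exactly `A` and yields a UNIT zero**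
`a₁ := (ζ − 1)/ϖ^A` of the residue polynomial: `‖a₁‖ = 1`, `1 + ϖ^A a₁ = ζ`, `‖a₁ + c·a₁^p‖ < 1`
(the congruence, with `L(ζ) = 0`). [cite: Washington1997, §5.1] -/
theorem exists_unit_zero_of_pow_prime_eq_one (hp2 : p ≠ 2) (hpA : ¬ p ∣ A) {ζ : K} (hζ : ζ ^ p = 1)
    (hζ1 : ζ ≠ 1) :
    ∃ a : K, ‖a‖ = 1 ∧ 1 + (ϖ : K) ^ A * a = ζ ∧ ‖a + (ϖ : K) ^ absRamificationIdx p K / (p : K) * a ^ p‖ < 1 := by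
  have hρ0 : 0 < ‖(ϖ : K)‖ := norm_units_pos ϖ
  have hϖA0 : (ϖ : K) ^ A ≠ 0 := pow_ne_zero _ ϖ.ne_zero
  have hζP := isPrincipal_of_pow_prime_eq_one p hζ
  have hL := logSeries_eq_zero_of_pow_prime_eq_one p hζ
  have hn := norm_one_sub_eq_of_logSeries_eq_zero p hϖ hA hpA hζP hζ1 hL
  have ha1 : ‖(ζ - 1) / (ϖ : K) ^ A‖ = 1 := by
    rw [norm_div, ← norm_neg, neg_sub, hn, norm_pow, div_self (pow_ne_zero _ hρ0.ne')]
  refine ⟨(ζ - 1) / (ϖ : K) ^ A, ha1, ?_, ?_⟩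
  · field_simp
    ring
  · have hcong := norm_logSeries_sub_le_level p hϖ hA hp2 ha1.le
    rw [mul_div_cancel₀ _ hϖA0, add_sub_cancel, hL, zero_sub, norm_neg, norm_mul, norm_pow, pow_succ] at hcong
    have h := le_of_mul_le_mul_left hcong (pow_pos hρ0 _)
    exact h.trans_lt hϖ.1

/-! ### §5. `ζ_p ∉ K`: the critical level is full, `r_in = A` -/

/-- **`ζ_p ∉ K` ⇒ `{‖z‖ ≤ ‖ϖ‖^A} ⊆ log_p(𝒪_K^×)`** (`p` odd, `e = A(p−1)`, `p ∤ A`): the residue polynomial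
`ā ↦ ā + c̄·ā^p` has trivial kernel (a unit zero would lift to `ζ_p`), hence is onto the finite residue
field, so every `z` with `‖z‖ ≤ ‖ϖ‖^A` is `L(1 + ϖ^A a)` up to an element of `𝔪^{A+1} ⊆ log_p(𝒪^×)`.
[cite: Washington1997, §5.1] [cite: NeukirchANT1999, Ch. II Prop. (5.7)] -/
theorem closedBall_level_subset_logUnits_of_forall_pow_prime_eq_one (hp2 : p ≠ 2) (hpA : ¬ p ∣ A)
    (hμ : ∀ ζ : K, ζ ^ p = 1 → ζ = 1) : closedBall (0 : K) (‖(ϖ : K)‖ ^ A) ⊆ logUnits K := by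
  intro z hz
  rw [mem_closedBall, dist_zero_right] at hz
  have hρ0 : 0 < ‖(ϖ : K)‖ := norm_units_pos ϖ
  have hA1 := one_le_level p hA
  have hϖA0 : (ϖ : K) ^ A ≠ 0 := pow_ne_zero _ ϖ.ne_zero
  have hc1 := norm_coeff_level_eq_one p hϖ
  let C : Valued.integer K := ⟨(ϖ : K) ^ absRamificationIdx p K / (p : K), Valued.integer.mem_iff.mpr hc1.le⟩
  haveI := charP_residueField p K
  haveI : Finite (IsLocalRing.ResidueField (Valued.integer K)) := finite_residueField
  -- trivial kernel (via the lift), hence onto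
  have hker := addPoly_ker_trivial_of_norm p C fun a ha hΛ => by
    by_contra hlt
    have ha1 : ‖a‖ = 1 := le_antisymm ha (not_lt.mp hlt)
    obtain ⟨ζ, hζ, hζ1⟩ := exists_pow_prime_eq_one_of_unit_zero p hϖ hA hp2 hpA ha1 hΛ
    exact hζ1 (hμ ζ hζ)
  have hsurj := addPoly_surjective_of_ker p _ hker
  -- solve `a + c·a^p ≡ z/ϖ^A (mod 𝔪)`
  have hb : ‖z / (ϖ : K) ^ A‖ ≤ 1 := by
    rw [norm_div, norm_pow, div_le_one (pow_pos hρ0 _)]; exact hz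
  obtain ⟨a, ha, hab⟩ := exists_norm_add_mul_pow_sub_lt_one_of_surjective p C hsurj (z / (ϖ : K) ^ A) hb
  have hab' : ‖a + (ϖ : K) ^ absRamificationIdx p K / (p : K) * a ^ p - z / (ϖ : K) ^ A‖ ≤ ‖(ϖ : K)‖ :=
    hϖ.norm_le_of_norm_lt_one _ hab
  -- `z − L(1 + ϖ^A a) ∈ 𝔪^{A+1} ⊆ log_p(𝒪^×)`
  have hcong := norm_logSeries_sub_le_level p hϖ hA hp2 ha
  have hdiff : ‖z - logSeries (1 + (ϖ : K) ^ A * a)‖ ≤ ‖(ϖ : K)‖ ^ (A + 1) := by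
    have hsplit : z - logSeries (1 + (ϖ : K) ^ A * a) =
        -((ϖ : K) ^ A * (a + (ϖ : K) ^ absRamificationIdx p K / (p : K) * a ^ p - z / (ϖ : K) ^ A)) +
        -(logSeries (1 + (ϖ : K) ^ A * a) -
          (ϖ : K) ^ A * (a + (ϖ : K) ^ absRamificationIdx p K / (p : K) * a ^ p)) := by
      rw [mul_sub, mul_div_cancel₀ _ hϖA0]; ring
    rw [hsplit]
    refine (IsUltrametricDist.norm_add_le_max _ _).trans (max_le ?_ ?_)
    · rw [norm_neg, norm_mul, norm_pow, pow_succ]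
      exact mul_le_mul_of_nonneg_left hab' (pow_nonneg hρ0.le _)
    · rw [norm_neg]
      exact hcong
  have h1 : z - logSeries (1 + (ϖ : K) ^ A * a) ∈ logUnits K := by
    refine closedBall_div_succ_subset_logUnits p hϖ ?_
    rw [div_eq_level p hA, mem_closedBall, dist_zero_right]
    exact hdiff
  have hyP : IsPrincipal (1 + (ϖ : K) ^ A * a) := by
    show ‖1 - (1 + (ϖ : K) ^ A * a)‖ < 1
    rw [show (1 : K) - (1 + (ϖ : K) ^ A * a) = -((ϖ : K) ^ A * a) by ring, norm_neg, norm_mul, norm_pow]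
    exact (mul_le_of_le_one_right (pow_nonneg hρ0.le _) ha).trans_lt
      (pow_lt_one₀ (norm_nonneg _) hϖ.1 (by omega))
  have h2 : logSeries (1 + (ϖ : K) ^ A * a) ∈ logUnits K := by
    rw [← unitLog_of_isPrincipal p hyP]; exact unitLog_mem_logUnits hyP.norm_eq_one
  have h3 := (logUnitsAddSubgroup p K).add_mem h1 h2
  rwa [sub_add_cancel] at h3

/-- **`r_in = A = e/(p−1)` EXACTLY when `ζ_p ∉ K`** (`p` odd, `e = A·(p−1)`, `p ∤ A`), in the R-W format:
`closedBall 0 ‖ϖ‖^A ⊆ log_p(𝒪_K^×)` and `¬ closedBall 0 ‖ϖ‖^{A−1} ⊆ log_p(𝒪_K^×)`.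
[cite: NeukirchANT1999, Ch. II Prop. (5.5)–(5.7)] -/
theorem innerRadius_tie_of_forall_pow_prime_eq_one (hp2 : p ≠ 2) (hpA : ¬ p ∣ A)
    (hμ : ∀ ζ : K, ζ ^ p = 1 → ζ = 1) :
    closedBall (0 : K) (‖(ϖ : K)‖ ^ A) ⊆ logUnits K ∧
      ¬ closedBall (0 : K) (‖(ϖ : K)‖ ^ (A - 1)) ⊆ logUnits K :=
  ⟨closedBall_level_subset_logUnits_of_forall_pow_prime_eq_one p hϖ hA hp2 hpA hμ,
    not_closedBall_pred_subset_logUnits p hϖ hA hpA⟩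

end Field

end LogEnvelope

end Literature.IUT.LogVolume

end
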